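import Summits.QuantumFields.BalabanUV.T4Continuum.Support.DirichletStarRenormSlabNoGo
import Summits.QuantumFields.BalabanUV.T4Continuum.Support.RegionStarLineGaugeRegion
import Summits.QuantumFields.BalabanUV.T4Continuum.Support.DirichletScalarTowerPotential

/-!
# T⁴ programme, spine node NE2 (U1a), sub-row Δ1 «NE2⁰-Dirichlet» — THE RENORMALISED AND THE COMPRESSED INJECTED LAWS DIFFER EXACTLY BY A
# COMMUTATOR: `J̃ = J·N` with the DEFICIENCY WEIGHTS `N = diag(√(L^d∕nch))`, hence `T̃ = T·N + J·(D⁻¹N − ND⁻¹)` (`T̃` = W3̃'s matrix, `T` = W3's);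
# on the one-block slab: `√L·‖T_k‖ + ‖D_k⁻¹N_k − N_kD_k⁻¹‖ ≳ n_k^{−1/2}` — King's compressed law at rate `L⁻¹` FORCES the coarse Green's operator
# NOT to commute with the deficiency weights to that order

NE2 formalisation swarm `b2b-balaban-t4-ne2-formalise-*`, LEAF PROVER 02 (gen 7), supplier item «Δ1-VEC-W3̃-SLAB-NOGO», file 4 (structure), on
file 3 `Support/DirichletStarRenormSlabNoGo` (`Tdef`, `opNorm_Tdef_ge`) and the owner's `Support/DirichletSubregionTowerOf` (p224434: King's compressed
injection `JpR`) / `Support/DirichletSubregionRenormTower` (p228571: `JnR`, `nch`).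

 * §1 (any carrier family `p`) **`JnR_eq_JpR_mul_defW : JnR k = JpR k * defW k`**, `defW k = diagonal (i ↦ √(L^d)·(√(nch i))⁻¹)` (= `1` on indices all
   of whose `L^d` children are carriers, `= √L` on the deficient star indices of a slab); **`renorm_sub_compressed`**:
   `D′⁻¹J̃ − J̃D⁻¹ = (D′⁻¹J − JD⁻¹)·N + J·(D⁻¹N − ND⁻¹)` for every `D`, `D′`;
 * (`opNorm_diagonal_le'` is the tree's, `DirichletScalarTowerPotential`);
 * §2 (slab) `isEThin_slabS` (the slab is in leaf-09's W1 class), `opNorm_defW_slab_le : ‖N_k‖ ≤ √L` (entries `1` ∕ `√L` by `nch_eq`) and **`lower_le_compressed_add_comm`**: the explicit lower bound of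
   file 3 (`opNorm_Tdef_ge`'s left side, of order `n_k^{−1/2}`) is `≤ √L·‖T_k‖ + ‖D_k⁻¹N_k − N_kD_k⁻¹‖`.

HONEST FRAMING (T4-DAG p. 1).  Bookkeeping at MODEL level (`U = 1`, one region, one averaging scale, finite torus, operator norm); statements OURS
([folklore]); it does NOT say that W3 (King's compressed injected law) fails — only that W3 at rate `L⁻¹` and a commuting coarse Green's operator
cannot BOTH hold on the slab; NE2 (U1a) NOT proved; spine 0/9 unchanged; NOT [B9] (3.16)/(3.23)–(3.27) as printed; NOT infinite volume, NOT a mass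
gap, NOT the Clay problem, NOT summit progress.  HONEST DEPENDENCY: continuum YM on T⁴ ⇐ BetaPertH ∧ nine spine estimates (0/9 proved); BetaPertH ⇐
(D1) ∧ (D4) ∧ CAP+tail; G-an2-4 gates asym, D1 and NE2/3/4.  No `sorry`.
-/

noncomputable section

open scoped BigOperators ComplexConjugate Matrix Matrix.Norms.L2Operator
open Finset

namespace Summit.QuantumFields.BalabanUV.T4Continuum.DirichletStarRenormVsCompressed

open Literature.MathematicalPhysics.QuantumFieldTheory.Balaban1983to89.B5Prop11Plancherel (Tor fine unitVec)
open Literature.MathematicalPhysics.QuantumFieldTheory.Balaban1983to89.B5Prop11Lower (nsq nsq_nonneg)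
open Literature.MathematicalPhysics.QuantumFieldTheory.Balaban1983to89.B5G183RateUnitTower (lev)
open Summit.QuantumFields.BalabanUV.T4Continuum
open Summit.QuantumFields.BalabanUV.T4Continuum.BalabanAveragedTowerUnit (idx)
open Summit.QuantumFields.BalabanUV.T4Continuum.BlockPairingGeometry (parT JK_apply)
open Summit.QuantumFields.BalabanUV.T4Continuum.KingPairingPlantedLaw (JpcT_eq_JK)
open Summit.QuantumFields.BalabanUV.T4Continuum.ScalarAveragedCompression (sigma0)
open Summit.QuantumFields.BalabanUV.T4Continuum.RegionGaugeFixedVector (starReg regionDeltaA)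
open Summit.QuantumFields.BalabanUV.T4Continuum.DirichletSubregionTowerOf (pidx JpR opNorm_JpR_le)
open Summit.QuantumFields.BalabanUV.T4Continuum.DirichletSubregionRenormTower (nch JnR)
open Summit.QuantumFields.BalabanUV.T4Continuum.DirichletStarVectorTower (starP)
open Summit.QuantumFields.BalabanUV.T4Continuum.DirichletStarRenormTower (nch_star_pos)
open Summit.QuantumFields.BalabanUV.T4Continuum.DirichletStarSlabMode (slabS)
open Summit.QuantumFields.BalabanUV.T4Continuum.DirichletStarSlabLayer (nch_eq)
open Summit.QuantumFields.BalabanUV.T4Continuum.DirichletStarRenormSlabNoGo (Tdef opNorm_Tdef_ge)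
open Summit.QuantumFields.BalabanUV.T4Continuum.DirichletScalarTowerPotential (opNorm_diagonal_le')
open Summit.QuantumFields.BalabanUV.T4Continuum.RegionStarLineGaugeRegion (IsEThin)
open Summit.QuantumFields.BalabanUV.Beta.GAN24.DirichletBoxTrace (blockReg)

variable {d : ℕ} (L : ℕ) [NeZero L] (M : Fin d → ℕ) [hM : ∀ μ, NeZero (M μ)]

/-! ## §1 `J̃ = J·N` and the commutator identity -/

section Generic

variable (p : (k : ℕ) → idx L M k → Prop) [hp : ∀ k, DecidablePred (p k)]

/-- THE DEFICIENCY WEIGHTS `N = diag(√(L^d)·(√nch)⁻¹)`: `1` on a coarse index all of whose `L^d` children are carriers, `> 1` otherwise. [folklore] -/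
def defW (k : ℕ) : Matrix (pidx L M p k) (pidx L M p k) ℂ :=
  Matrix.diagonal fun i => (((Real.sqrt ((L : ℝ) ^ d) * (Real.sqrt (nch L M p k i.1))⁻¹ : ℝ)) : ℂ)

/-- **`J̃ = J·N`**: the renormalised injection is King's compressed injection followed by the deficiency weights. [folklore] -/
theorem JnR_eq_JpR_mul_defW (k : ℕ) : JnR L M p k = JpR L M p k * defW L M p k := by
  have hLd : (0 : ℝ) < (L : ℝ) ^ d := pow_pos (by exact_mod_cast Nat.pos_of_ne_zero (NeZero.ne L)) d
  have hLc : ((L : ℂ) ^ d) ≠ 0 := pow_ne_zero _ (by exact_mod_cast NeZero.ne L)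
  have hss : ((((Real.sqrt ((L : ℝ) ^ d)) : ℝ) : ℂ)) * (((Real.sqrt ((L : ℝ) ^ d)) : ℝ) : ℂ) = (L : ℂ) ^ d := by
    rw [← Complex.ofReal_mul, Real.mul_self_sqrt hLd.le]; push_cast; rfl
  ext y i
  rw [defW, Matrix.mul_diagonal]
  simp only [JnR, JpR, Matrix.toBlock_apply, JpcT_eq_JK, JK_apply]
  by_cases h : parT (lev L k) L M y.1 = i.1
  · rw [if_pos h, if_pos h, mul_one, Complex.ofReal_mul]
    calc (((Real.sqrt (nch L M p k i.1))⁻¹ : ℝ) : ℂ)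
        = ((((Real.sqrt ((L : ℝ) ^ d)) : ℝ) : ℂ) * (((Real.sqrt ((L : ℝ) ^ d)) : ℝ) : ℂ)) * ((L : ℂ) ^ d)⁻¹
            * (((Real.sqrt (nch L M p k i.1))⁻¹ : ℝ) : ℂ) := by rw [hss, mul_inv_cancel₀ hLc, one_mul]
      _ = _ := by ring
  · simp [h]

omit hp in
/-- **THE COMMUTATOR IDENTITY**: `D′⁻¹(JN) − (JN)D⁻¹ = (D′⁻¹J − JD⁻¹)·N + J·(D⁻¹N − ND⁻¹)` (pure algebra). [folklore] -/
theorem renorm_sub_compressed {m m' : Type*} [Fintype m] [DecidableEq m] [Fintype m'] [DecidableEq m']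
    (D : Matrix m m ℂ) (D' : Matrix m' m' ℂ) (J : Matrix m' m ℂ) (N : Matrix m m ℂ) :
    D'⁻¹ * (J * N) - (J * N) * D⁻¹ = (D'⁻¹ * J - J * D⁻¹) * N + J * (D⁻¹ * N - N * D⁻¹) := by
  rw [Matrix.sub_mul, Matrix.mul_sub, ← Matrix.mul_assoc, ← Matrix.mul_assoc, Matrix.mul_assoc J N]
  abel

end Generic

/-! ## §2 On the slab: `‖N‖ ≤ √L`, and the dichotomy -/

section Slab

variable (i : Fin d) (a a' : ℝ)

/-- on the slab the deficiency weights are `1` (parent site in `Ω`) or `√L` (outer layer): `‖N_k‖ ≤ √L`. [folklore] -/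
theorem opNorm_defW_slab_le (k : ℕ) : ‖defW L M (starP L M (slabS M i)) k‖ ≤ Real.sqrt L := by
  have hd : 0 < d := Fin.pos i
  have hL1 : (1 : ℝ) ≤ L := by exact_mod_cast Nat.pos_of_ne_zero (NeZero.ne L)
  have hLpos : (0 : ℝ) < L := by linarith
  refine opNorm_diagonal_le' (Real.sqrt_nonneg _) fun j => ?_
  rw [Complex.norm_real, Real.norm_of_nonneg (by positivity), nch_eq]
  have e : (L : ℝ) ^ d = (L : ℝ) ^ (d - 1) * L := by rw [← pow_succ, Nat.sub_add_cancel hd]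
  split_ifs with hb
  · rw [mul_inv_cancel₀ (Real.sqrt_pos.mpr (pow_pos hLpos d)).ne']
    rw [← Real.sqrt_one]; exact Real.sqrt_le_sqrt hL1
  · rw [e, Real.sqrt_mul (pow_nonneg hLpos.le _), mul_comm (Real.sqrt ((L : ℝ) ^ (d - 1))), mul_assoc,
      mul_inv_cancel₀ (Real.sqrt_pos.mpr (pow_pos hLpos _)).ne', mul_one]

/-- **THE DICHOTOMY ON THE SLAB**: file 3's explicit lower bound for `‖T̃_k‖` is at most `√L·‖T_k‖ + ‖D_k⁻¹N_k − N_kD_k⁻¹‖`, `T_k` = the matrix of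
King's COMPRESSED injected law W3 — if W3 holds at the torus rate, the coarse Green's operator `Δ_a(Ω₀)_k⁻¹` fails to commute with the deficiency
weights at order `n_k^{−1/2}` (the normal boundary trace of the Green's operator). [folklore] -/
theorem lower_le_compressed_add_comm (hMi : 3 ≤ M i) (ha : 0 < a) (ha' : 0 < a') (k : ℕ) :
    ((Real.sqrt (L : ℝ))⁻¹ * (Real.sqrt L - 1) ^ 2 * (((lev L (k + 1) : ℕ) : ℝ) ^ 2 - (sigma0 d a')⁻¹)
        - a * Real.sqrt (((lev L k : ℕ) : ℝ) + 1) * (Real.sqrt (((lev L (k + 1) : ℕ) : ℝ) + 1) + (Real.sqrt L - 1)))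
      / (a * Real.sqrt (((lev L k : ℕ) : ℝ) + 1)
          * (a * Real.sqrt (((lev L (k + 1) : ℕ) : ℝ) + 1) + (Real.sqrt L - 1) * (2 * Real.sqrt d * (((lev L (k + 1) : ℕ) : ℝ)) ^ 2 + a)))
      ≤ Real.sqrt L * ‖(regionDeltaA (lev L (k + 1)) M a a' (slabS M i))⁻¹ * JpR L M (starP L M (slabS M i)) k
              - JpR L M (starP L M (slabS M i)) k * (regionDeltaA (lev L k) M a a' (slabS M i))⁻¹‖
        + ‖(regionDeltaA (lev L k) M a a' (slabS M i))⁻¹ * defW L M (starP L M (slabS M i)) k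
              - defW L M (starP L M (slabS M i)) k * (regionDeltaA (lev L k) M a a' (slabS M i))⁻¹‖ := by
  set S := slabS M i
  set D := regionDeltaA (lev L k) M a a' S
  set D' := regionDeltaA (lev L (k + 1)) M a a' S
  set J := JpR L M (starP L M S) k
  set N := defW L M (starP L M S) k
  have h0 := opNorm_Tdef_ge L M i a a' hMi ha ha' k
  have e : Tdef L M i a a' k = (D'⁻¹ * J - J * D⁻¹) * N + J * (D⁻¹ * N - N * D⁻¹) := by
    show D'⁻¹ * JnR L M (starP L M S) k - JnR L M (starP L M S) k * D⁻¹ = _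
    rw [JnR_eq_JpR_mul_defW]
    exact renorm_sub_compressed D D' J N
  rw [e] at h0
  refine h0.trans ((norm_add_le _ _).trans (add_le_add ?_ ?_))
  · calc ‖(D'⁻¹ * J - J * D⁻¹) * N‖ ≤ ‖D'⁻¹ * J - J * D⁻¹‖ * ‖N‖ := Matrix.l2_opNorm_mul _ _
      _ ≤ ‖D'⁻¹ * J - J * D⁻¹‖ * Real.sqrt L := mul_le_mul_of_nonneg_left (opNorm_defW_slab_le L M i k) (norm_nonneg _)
      _ = Real.sqrt L * ‖D'⁻¹ * J - J * D⁻¹‖ := mul_comm _ _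
  · calc ‖J * (D⁻¹ * N - N * D⁻¹)‖ ≤ ‖J‖ * ‖D⁻¹ * N - N * D⁻¹‖ := Matrix.l2_opNorm_mul _ _
      _ ≤ 1 * ‖D⁻¹ * N - N * D⁻¹‖ := mul_le_mul_of_nonneg_right (opNorm_JpR_le L M (starP L M S) k) (norm_nonneg _)
      _ = ‖D⁻¹ * N - N * D⁻¹‖ := one_mul _

omit [NeZero L] hM in
/-- the one-block slab is `i`-THIN (`IsEThin`, leaf-09's class on which W1 is a THEOREM — `RegionStarLineGaugeTower.sliceCoercive_of_isEThin'`):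
on it W1 and (box) interior W2 are in the tree, and W3̃ at the torus rate is refuted (file 3). [folklore] -/
theorem isEThin_slabS (hMi : 2 ≤ M i) : IsEThin M i (slabS M i) := by
  haveI : Fact (1 < M i) := ⟨hMi⟩
  have h1 : (1 : ZMod (M i)) ≠ 0 := one_ne_zero
  have key : ∀ y : Tor M, slabS M i y → ∀ v : Tor M, v i = 0 → ¬ slabS M i (y + v + unitVec M i) := by
    intro y hy v hv h
    have e : (y + v + unitVec M i) i = 1 := by
      rw [Pi.add_apply, Pi.add_apply, unitVec, Pi.single_eq_same, show y i = 0 from hy, hv, zero_add, zero_add]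
    exact h1 (e.symm.trans h)
  have hν0 : ∀ ν : Fin d, ν ≠ i → unitVec M ν i = 0 := fun ν hν => by
    rw [unitVec, Pi.single_eq_of_ne (Ne.symm hν)]
  refine ⟨fun y hy => ?_, fun y ν hν hy => ⟨?_, ?_⟩⟩
  · have := key y hy 0 rfl; rwa [add_zero] at this
  · exact key y hy (unitVec M ν) (hν0 ν hν)
  · have := key y hy (-unitVec M ν) (by rw [Pi.neg_apply, hν0 ν hν, neg_zero]); rwa [← sub_eq_add_neg] at this

end Slab

end Summit.QuantumFields.BalabanUV.T4Continuum.DirichletStarRenormVsCompressed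

end
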